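import Mathlib
import Summits.Ventures.HodgeRepro2.NonVanishingSelfAdjointEigenform
import Summits.Ventures.HodgeRepro2.FormalAdjointEigenvalue

/-!
# DoubleCosetMem — `S δ' S = S δ S` iff `δ' ∈ S δ S`, and the Hecke consequences in membership form

Blind cell `pub-hodge-repro2`, seat p2 (Tier 5 kernel support, Hecke side).

The double-coset identity `S δ S = S δ⁻¹ S` used in `HeckeSlashDoubleCoset.lean` /
`NonVanishingSelfAdjointEigenform.lean` is equivalent to the membership `δ⁻¹ ∈ S δ S` — the form in
which it is usually verified (e.g. from an anti-involution of the group preserving `S`). This file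
records the elementary equivalence and restates the two Hecke results with the membership hypothesis:

* `mem_doubleCoset_self`, `doubleCoset_eq_of_mem`, `doubleCoset_eq_iff_mem`, `inv_mem_doubleCoset_of_conj`
  (`δ` conjugate to `δ⁻¹` by an element of `S` ⇒ `δ⁻¹ ∈ S δ S`);
* `heckeFamilyOf_eq_inv_of_inv_mem_doubleCoset`: `δ⁻¹ ∈ S δ S ⇒ T_δ = T_{δ⁻¹}` on the Petersson space;
* `NonVanishingInput.exists_hecke_eigenform_of_inv_mem_doubleCoset`: the Tier-3 input gives a unit
  holomorphic `T_δ`-eigenform with non-zero (N)-period for every rational unitary `δ` with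
  `δ⁻¹ ∈ S'δS'`;
* `heckeFamilyOf_eigenvalue_real_of_eq_inv` / `NonVanishingInput.exists_hecke_eigenform_real_of_inv_mem_doubleCoset`:
  the eigenvalue of such a self-adjoint `T_δ` is REAL (`(T_δ, T_{δ⁻¹})` is a formal adjoint pair, so
  `μ = conj μ`), hence the eigenform above has a real Hecke eigenvalue.
-/

namespace Summit.Ventures.HodgeRepro2.ShimuraData

open MeasureTheory

variable {K : Type*} [Field K] {S : Subgroup (GL (Fin 3) K)} {δ δ' : GL (Fin 3) K}

/-- `δ ∈ S δ S`. -/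
theorem mem_doubleCoset_self (S : Subgroup (GL (Fin 3) K)) (δ : GL (Fin 3) K) :
    δ ∈ doubleCoset S δ :=
  ⟨1, one_mem _, 1, one_mem _, by rw [one_mul, mul_one]⟩

/-- `S δ S` is closed under left and right multiplication by `S`. -/
theorem mul_mem_doubleCoset_mul {x : GL (Fin 3) K} (hx : x ∈ doubleCoset S δ) {s₁ s₂ : GL (Fin 3) K}
    (hs₁ : s₁ ∈ S) (hs₂ : s₂ ∈ S) : s₁ * x * s₂ ∈ doubleCoset S δ := by
  obtain ⟨t₁, ht₁, t₂, ht₂, rfl⟩ := hx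
  exact ⟨s₁ * t₁, mul_mem hs₁ ht₁, t₂ * s₂, mul_mem ht₂ hs₂, by simp only [mul_assoc]⟩

/-- If `δ' ∈ S δ S` then `S δ' S ⊆ S δ S`. -/
theorem doubleCoset_subset_of_mem (h : δ' ∈ doubleCoset S δ) : doubleCoset S δ' ⊆ doubleCoset S δ := by
  rintro x ⟨s₁, hs₁, s₂, hs₂, rfl⟩
  exact mul_mem_doubleCoset_mul h hs₁ hs₂

/-- If `δ' ∈ S δ S` then `δ ∈ S δ' S`. -/
theorem mem_doubleCoset_symm (h : δ' ∈ doubleCoset S δ) : δ ∈ doubleCoset S δ' := by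
  obtain ⟨s₁, hs₁, s₂, hs₂, rfl⟩ := h
  refine ⟨s₁⁻¹, inv_mem hs₁, s₂⁻¹, inv_mem hs₂, ?_⟩
  group

/-- If `δ' ∈ S δ S` then `S δ' S = S δ S`. -/
theorem doubleCoset_eq_of_mem (h : δ' ∈ doubleCoset S δ) : doubleCoset S δ' = doubleCoset S δ :=
  Set.Subset.antisymm (doubleCoset_subset_of_mem h)
    (doubleCoset_subset_of_mem (mem_doubleCoset_symm h))

/-- `S δ' S = S δ S` iff `δ' ∈ S δ S`. -/
theorem doubleCoset_eq_iff_mem : doubleCoset S δ' = doubleCoset S δ ↔ δ' ∈ doubleCoset S δ :=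
  ⟨fun h => h ▸ mem_doubleCoset_self S δ', doubleCoset_eq_of_mem⟩

/-- If `δ` is conjugate to `δ⁻¹` by an element of `S` (e.g. a Weyl element swapping the entries
of a diagonal `δ`), then `δ⁻¹ ∈ S δ S`. -/
theorem inv_mem_doubleCoset_of_conj {w : GL (Fin 3) K} (hw : w ∈ S) (h : w * δ * w⁻¹ = δ⁻¹) :
    δ⁻¹ ∈ doubleCoset S δ :=
  ⟨w, hw, w⁻¹, inv_mem hw, h.symm⟩

section hecke

variable [NumberField K] [NumberField.IsCMField K] {τ₁ : K →+* ℂ} {H : Matrix (Fin 3) (Fin 3) K}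
  {Q : Matrix (Fin 3) (Fin 3) ℂ} {𝔪 : Submodule ℤ (Fin 3 → K)}

/-- **`T_δ = T_{δ⁻¹}` when `δ⁻¹ ∈ S δ S`** (membership form of
`heckeFamilyOf_eq_inv_of_doubleCoset_eq`). -/
theorem heckeFamilyOf_eq_inv_of_inv_mem_doubleCoset (hQ : IsFrame K τ₁ H Q)
    (S : Subgroup (GL (Fin 3) K)) (hS : (S : Set (GL (Fin 3) K)) ⊆ unitaryGroup K H)
    [CompactSpace (ballQuotient hQ S hS)] {D : Set ball₂} (k : ℕ)
    (hD : IsBallFundamentalDomain hQ S hS D) (hDm : MeasurableSet D)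
    (inst : ∀ δ : unitaryGroup K H,
      Fintype (S ⧸ (heckeSubgroup S (δ : GL (Fin 3) K)).subgroupOf S))
    {δ : unitaryGroup K H} (hmem : (δ : GL (Fin 3) K)⁻¹ ∈ doubleCoset S (δ : GL (Fin 3) K)) :
    heckeFamilyOf hQ S hS k hD hDm inst δ = heckeFamilyOf hQ S hS k hD hDm inst δ⁻¹ :=
  heckeFamilyOf_eq_inv_of_doubleCoset_eq hQ S hS k hD hDm inst (doubleCoset_eq_of_mem hmem).symm

/-- **Eigenform of a single Hecke operator with non-zero (N)-period, under `δ⁻¹ ∈ S'δS'`** —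
`NonVanishingInput.exists_hecke_eigenform_of_doubleCoset_eq_inv` in membership form. -/
theorem NonVanishingInput.exists_hecke_eigenform_of_inv_mem_doubleCoset (hH : IsHermitianForm K H)
    (hdef : ∀ τ : K →+* ℂ, NumberField.InfinitePlace.mk τ ≠ NumberField.InfinitePlace.mk τ₁ →
      IsDefiniteAt K τ H)
    (hQ : IsFrame K τ₁ H Q) (h𝔪 : IsLattice K 𝔪) (hnv : NonVanishingInput K τ₁ H 𝔪 Q) {N : ℕ}
    (hN : 2 < N)
    [CompactSpace (ballQuotient hQ (shimuraLevelSubgroup K H 𝔪 1)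
      (shimuraLevelSubgroup_one_subset_unitaryGroup H 𝔪))] :
    ∃ S' : Subgroup (GL (Fin 3) K), ∃ hS' : (S' : Set (GL (Fin 3) K)) ⊆ shimuraLevel K H 𝔪 N,
      IsTorsionFreeSet K (S' : Set (GL (Fin 3) K)) ∧
      ∃ hS₁ : S' ≤ shimuraLevelSubgroup K H 𝔪 1,
      ∃ hfin : (S'.subgroupOf (shimuraLevelSubgroup K H 𝔪 1)).FiniteIndex,
      ∃ _hc : CompactSpace (ballQuotient hQ S' (subset_unitaryGroup_of_subset_shimuraLevel hS')),
      ∃ D : Set ball₂, ∃ hDm : MeasurableSet D,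
      ∃ hD : IsBallFundamentalDomain hQ S' (subset_unitaryGroup_of_subset_shimuraLevel hS') D,
      ∃ f : PeterssonForms hQ S' (subset_unitaryGroup_of_subset_shimuraLevel hS') 3 hD,
        f ∈ holomorphicForms hQ S' _ 3 hD ∧
        (SeparationQuotient.mk f : PeterssonSpace hQ S' _ 3 hD) ≠ 0 ∧
        ∀ δ : unitaryGroup K H, (δ : GL (Fin 3) K)⁻¹ ∈ doubleCoset S' (δ : GL (Fin 3) K) →
          ∃ v : PeterssonSpace hQ S' _ 3 hD, v ∈ holomorphicSpace hQ S' _ 3 hD ∧ ‖v‖ = 1 ∧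
            (∃ μ : ℂ, heckeFamilyOf hQ S' _ 3 hD hDm
              (fun δ => fintypeHeckeQuotientOfFiniteIndex h𝔪 hS₁ hfin δ.2) δ v = μ • v) ∧
            inner ℂ v (SeparationQuotient.mk f : PeterssonSpace hQ S' _ 3 hD) ≠ 0 := by
  obtain ⟨S', hS', htf, hS₁, hfin, hc, D, hDm, hD, f, hfhol, hfne, hmain⟩ :=
    hnv.exists_hecke_eigenform_of_doubleCoset_eq_inv hH hdef hQ h𝔪 hN
  exact ⟨S', hS', htf, hS₁, hfin, hc, D, hDm, hD, f, hfhol, hfne,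
    fun δ hmem => hmain δ (doubleCoset_eq_of_mem hmem).symm⟩

/-- **Real eigenvalues of a self-adjoint Hecke operator.** If `T_δ = T_{δ⁻¹}` on the Petersson
space and `T_δ v = μ • v` with `v ≠ 0`, then `μ` is real. -/
theorem heckeFamilyOf_eigenvalue_real_of_eq_inv (hQ : IsFrame K τ₁ H Q)
    (S : Subgroup (GL (Fin 3) K)) (hS : (S : Set (GL (Fin 3) K)) ⊆ unitaryGroup K H)
    [CompactSpace (ballQuotient hQ S hS)] {D : Set ball₂} (k : ℕ)
    (hD : IsBallFundamentalDomain hQ S hS D) (hDm : MeasurableSet D)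
    (inst : ∀ δ : unitaryGroup K H,
      Fintype (S ⧸ (heckeSubgroup S (δ : GL (Fin 3) K)).subgroupOf S))
    {δ : unitaryGroup K H}
    (hself : heckeFamilyOf hQ S hS k hD hDm inst δ = heckeFamilyOf hQ S hS k hD hDm inst δ⁻¹)
    {v : PeterssonSpace hQ S hS k hD} (hv : v ≠ 0) {μ : ℂ}
    (hμ : heckeFamilyOf hQ S hS k hD hDm inst δ v = μ • v) : ∃ r : ℝ, μ = r := by
  have hadj := isFormalAdjointPair_heckeFamilyOf hQ S hS k hD hDm inst δ
  have hμ' : heckeFamilyOf hQ S hS k hD hDm inst δ⁻¹ v = μ • v := by rw [← hself]; exact hμ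
  have := JointEigenbasis.IsFormalAdjointPair.eigenvalue_eq_conj hadj hv hμ hμ'
  exact Complex.conj_eq_iff_real.mp this.symm

/-- **Eigenform of a single Hecke operator with REAL eigenvalue and non-zero (N)-period, under
`δ⁻¹ ∈ S'δS'`.** -/
theorem NonVanishingInput.exists_hecke_eigenform_real_of_inv_mem_doubleCoset
    (hH : IsHermitianForm K H)
    (hdef : ∀ τ : K →+* ℂ, NumberField.InfinitePlace.mk τ ≠ NumberField.InfinitePlace.mk τ₁ →
      IsDefiniteAt K τ H)
    (hQ : IsFrame K τ₁ H Q) (h𝔪 : IsLattice K 𝔪) (hnv : NonVanishingInput K τ₁ H 𝔪 Q) {N : ℕ}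
    (hN : 2 < N)
    [CompactSpace (ballQuotient hQ (shimuraLevelSubgroup K H 𝔪 1)
      (shimuraLevelSubgroup_one_subset_unitaryGroup H 𝔪))] :
    ∃ S' : Subgroup (GL (Fin 3) K), ∃ hS' : (S' : Set (GL (Fin 3) K)) ⊆ shimuraLevel K H 𝔪 N,
      IsTorsionFreeSet K (S' : Set (GL (Fin 3) K)) ∧
      ∃ hS₁ : S' ≤ shimuraLevelSubgroup K H 𝔪 1,
      ∃ hfin : (S'.subgroupOf (shimuraLevelSubgroup K H 𝔪 1)).FiniteIndex,
      ∃ _hc : CompactSpace (ballQuotient hQ S' (subset_unitaryGroup_of_subset_shimuraLevel hS')),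
      ∃ D : Set ball₂, ∃ hDm : MeasurableSet D,
      ∃ hD : IsBallFundamentalDomain hQ S' (subset_unitaryGroup_of_subset_shimuraLevel hS') D,
      ∃ f : PeterssonForms hQ S' (subset_unitaryGroup_of_subset_shimuraLevel hS') 3 hD,
        f ∈ holomorphicForms hQ S' _ 3 hD ∧
        (SeparationQuotient.mk f : PeterssonSpace hQ S' _ 3 hD) ≠ 0 ∧
        ∀ δ : unitaryGroup K H, (δ : GL (Fin 3) K)⁻¹ ∈ doubleCoset S' (δ : GL (Fin 3) K) →
          ∃ v : PeterssonSpace hQ S' _ 3 hD, v ∈ holomorphicSpace hQ S' _ 3 hD ∧ ‖v‖ = 1 ∧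
            (∃ r : ℝ, heckeFamilyOf hQ S' _ 3 hD hDm
              (fun δ => fintypeHeckeQuotientOfFiniteIndex h𝔪 hS₁ hfin δ.2) δ v = (r : ℂ) • v) ∧
            inner ℂ v (SeparationQuotient.mk f : PeterssonSpace hQ S' _ 3 hD) ≠ 0 := by
  obtain ⟨S', hS', htf, hS₁, hfin, hc, D, hDm, hD, f, hfhol, hfne, hmain⟩ :=
    hnv.exists_hecke_eigenform_of_inv_mem_doubleCoset hH hdef hQ h𝔪 hN
  refine ⟨S', hS', htf, hS₁, hfin, hc, D, hDm, hD, f, hfhol, hfne, fun δ hmem => ?_⟩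
  obtain ⟨v, hv, hnorm, ⟨μ, hμ⟩, hinner⟩ := hmain δ hmem
  haveI := hc
  have hv0 : v ≠ 0 := by
    intro h
    rw [h, norm_zero] at hnorm
    exact zero_ne_one hnorm
  obtain ⟨r, hr⟩ := heckeFamilyOf_eigenvalue_real_of_eq_inv hQ S'
    (subset_unitaryGroup_of_subset_shimuraLevel hS') 3 hD hDm
    (fun δ => fintypeHeckeQuotientOfFiniteIndex h𝔪 hS₁ hfin δ.2)
    (heckeFamilyOf_eq_inv_of_inv_mem_doubleCoset hQ S' _ 3 hD hDm _ hmem) hv0 hμ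
  exact ⟨v, hv, hnorm, ⟨r, by rw [← hr]; exact hμ⟩, hinner⟩

end hecke

end Summit.Ventures.HodgeRepro2.ShimuraData
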